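import Literature.NumberTheory.Transcendental.KZIntervalPeriodProofs
import Literature.NumberTheory.Transcendental.SemialgebraicLineDeriv
import Literature.NumberTheory.Transcendental.KZCubicalCalculus
import Mathlib.MeasureTheory.Integral.IntervalIntegral.FundThmCalculus
import Mathlib.Analysis.SpecialFunctions.Trigonometric.ArctanDeriv
import Mathlib.Analysis.Calculus.Deriv.Polynomial
import Mathlib.Topology.Algebra.Polynomial

/-!
# `StokesGeneration` (stmt-KontsevichZagierPeriods-3586) — line `fibrewise_stokes`, stub `stub_rungArctanFTC`

Registered rung stub R13 (rung 4) of the line `fibrewise_stokes` of the crux `StokesGeneration`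
(route UnfoldedStokes): **the one-piece fundamental theorem of calculus for the phase of a
polynomial loop**.

Rung 4 (full angular sector of the residual, root-free) cuts a polynomial loop `P` into pieces; on
a piece `[a, b]` the re-centred loop is `U + iW` with real polynomials `U`, `W` and `U > 0` on
`[a, b]`. The phase increment of the piece is
`arctan (W/U)|ₐᵇ = ∫ₐᵇ (U W' − U' W)/(U² + W²) = ∫ₐᵇ Im (P'/P)`.

Proof: `F u = arctan (W u / U u)` is continuous on `[a, b]` (`U ≠ 0` there) and has derivative
`(1/(1 + (W/U)²)) · (W' U − W U')/U² = (U W' − U' W)/(U² + W²)` at every interior point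
(chain rule for `arctan` and the quotient rule, `Polynomial.hasDerivAt`); the integrand is
continuous on `[a, b]` since `U² + W² ≥ U² > 0`, hence interval integrable, and
`intervalIntegral.integral_eq_sub_of_hasDerivAt_of_le` concludes.

References: M. Kontsevich, D. Zagier, *Periods* (2001), §1.2 (Stokes/FTC among the three rules);
the computation itself is folklore calculus.
-/

noncomputable section

-- `Summit.KontsevichZagierPeriods.KontsevichZagierPeriods.…` is the tree's mandated layout (single-conjunct summit).
set_option linter.dupNamespace false

namespace Summit.KontsevichZagierPeriods.KontsevichZagierPeriods.Cruxes.StokesGeneration.FibrewiseStokes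

open MeasureTheory Set
open Literature.NumberTheory.Transcendental
open Literature.NumberTheory.Transcendental.KZ
open Literature.ModelTheory.ExponentialFields (IsSemialgebraic)

/-- Derivative of the phase `u ↦ arctan (W u / U u)` of the loop `U + iW` at a point `s` with
`U s ≠ 0`: it is `(U W' − U' W)/(U² + W²)` evaluated at `s` (chain rule for `arctan`, quotient
rule, and `1 + (W/U)² = (U² + W²)/U²`). [folklore] -/
theorem rungArctan_hasDerivAt (U W : Polynomial ℝ) {s : ℝ} (hU : U.eval s ≠ 0) :
    HasDerivAt (fun u => Real.arctan (W.eval u / U.eval u))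
      ((U.eval s * (Polynomial.derivative W).eval s
          - (Polynomial.derivative U).eval s * W.eval s) /
        (U.eval s ^ 2 + W.eval s ^ 2)) s := by
  have hq : HasDerivAt (fun u => W.eval u / U.eval u)
      (((Polynomial.derivative W).eval s * U.eval s
          - W.eval s * (Polynomial.derivative U).eval s) / U.eval s ^ 2) s :=
    (W.hasDerivAt s).div (U.hasDerivAt s) hU
  refine hq.arctan.congr_deriv ?_
  have hE : U.eval s ^ 2 + W.eval s ^ 2 ≠ 0 := by
    have h1 : 0 < U.eval s ^ 2 := by positivity
    have h2 : 0 ≤ W.eval s ^ 2 := sq_nonneg _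
    exact ne_of_gt (by linarith)
  field_simp

/-- Continuity of the phase `u ↦ arctan (W u / U u)` on a set where `U` does not vanish.
[folklore] -/
theorem rungArctan_continuousOn (U W : Polynomial ℝ) {t : Set ℝ}
    (hU : ∀ u ∈ t, U.eval u ≠ 0) :
    ContinuousOn (fun u => Real.arctan (W.eval u / U.eval u)) t :=
  Real.continuous_arctan.comp_continuousOn (W.continuousOn.div U.continuousOn hU)

/-- Continuity of the angular integrand `(U W' − U' W)/(U² + W²)` on a set where `U` does not
vanish (the denominator is `≥ U² > 0`). [folklore] -/
theorem rungArctan_integrand_continuousOn (U W : Polynomial ℝ) {t : Set ℝ}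
    (hU : ∀ u ∈ t, U.eval u ≠ 0) :
    ContinuousOn (fun u =>
      (U.eval u * (Polynomial.derivative W).eval u
          - (Polynomial.derivative U).eval u * W.eval u) /
        (U.eval u ^ 2 + W.eval u ^ 2)) t := by
  refine ContinuousOn.div ?_ ?_ ?_
  · exact (U.continuousOn.mul (Polynomial.derivative W).continuousOn).sub
      ((Polynomial.derivative U).continuousOn.mul W.continuousOn)
  · exact (U.continuousOn.pow 2).add (W.continuousOn.pow 2)
  · intro u hu
    have h1 : 0 < U.eval u ^ 2 := by
      have := hU u hu
      positivity
    have h2 : 0 ≤ W.eval u ^ 2 := sq_nonneg _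
    exact ne_of_gt (by linarith)

/-- **Registered stub `stub_rungArctanFTC` (R13, rung 4 of the line `fibrewise_stokes`).**
For real polynomials `U`, `W` with `U > 0` on `[a, b]` (`a ≤ b`), the phase increment of the loop
piece `U + iW` over `[a, b]` is the integral of its angular derivative:
`arctan (W b/U b) − arctan (W a/U a) = ∫ₐᵇ (U W' − U' W)/(U² + W²)`.
Fundamental theorem of calculus (`intervalIntegral.integral_eq_sub_of_hasDerivAt_of_le`) for
`F = arctan (W/U)`, continuous on `[a, b]` with the stated (continuous, hence interval-integrable)
derivative on `(a, b)`. [folklore] [cite: KontsevichZagier2001, §1.2] -/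
theorem stub_rungArctanFTC :
    ∀ (U W : Polynomial ℝ) (a b : ℝ), a ≤ b → (∀ u ∈ Set.Icc a b, 0 < U.eval u) →
      Real.arctan (W.eval b / U.eval b) - Real.arctan (W.eval a / U.eval a) =
        ∫ u in a..b, (U.eval u * (Polynomial.derivative W).eval u - (Polynomial.derivative U).eval u * W.eval u) /
          (U.eval u ^ 2 + W.eval u ^ 2) := by
  intro U W a b hab hpos
  have hU : ∀ u ∈ Set.Icc a b, U.eval u ≠ 0 := fun u hu => (hpos u hu).ne'
  symm
  refine intervalIntegral.integral_eq_sub_of_hasDerivAt_of_le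
    (f := fun u => Real.arctan (W.eval u / U.eval u)) hab
    (rungArctan_continuousOn U W hU)
    (fun x hx => rungArctan_hasDerivAt U W (hU x (Ioo_subset_Icc_self hx))) ?_
  exact (rungArctan_integrand_continuousOn U W hU).intervalIntegrable_of_Icc hab

end Summit.KontsevichZagierPeriods.KontsevichZagierPeriods.Cruxes.StokesGeneration.FibrewiseStokes
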